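import Summits.AtomisticToContinuum.Crystallization.Theses.SquareWellLayerCake

/-!
# Disproof of `StackingFaultSparsity` (stmt-AtomisticToContinuum-14296) — findings

Crux (shared by routes `LaminarSixThreeThree` / `SquareWellLayerCake`, same proposition —
`stackingFaultSparsity_shared`): for all `R > 0`, `ε ∈ (0, 1/4)` and every sequence of Lennard-Jones
ground states, the fraction of particles whose `R`-window is `(R, ε)`-matched to SOME Barlow stacking
`barlowStacking a h s` (`a, h ∈ (1/2, 2)`, `s` a Hägg sequence) but to NO `hcpStacking a h` tends to `0`.

## Verdict of this cycle: NO KILL — the crux resists every GS-free attack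

`¬ StackingFaultSparsity` needs a positive density of Barlow-but-not-hcp windows IN EXACT LJ GROUND
STATES for infinitely many `N`; the tree knows about exact ground states only existence
(`LennardJonesGroundStatesExist_holds`), injectivity and a minimal distance, so no Lean witness is
possible today, and the physics points the other way (hcp below fcc by `7.25e-5` per particle for
(12,6)-LJ lattice sums, Stillinger 2001; Schwerdtfeger–Burrows–Smits 2021).  What IS decidable without
ground states is recorded below as theorems.

## Contents

* §0 `WindowMatched` / `BarlowMatched` / `HcpMatched` and `stackingFaultSparsity_iff` (`Iff.rfl`):
  the crux is `∀ R ε …, ∀ GS-sequences, #{Barlow ∧ ¬hcp}/N → 0`.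
* §1 `hcp_twin` — **hcp windows are shell-paired**: for `z, p ∈ hcpStacking a h`, `p ≠ z`, there is a
  second point `p' ≠ p` of the stacking with `dist p' z = dist p z` (basal mirror through the layer of
  `z` for off-layer points, in-layer inversion for in-layer points).  Consequence used throughout: a
  window containing its centre and ONE further particle is never hcp-matched at small `ε`.
* §2 `window_cases` — in ANY Barlow stacking with `a = 199/100`, `h = 11/20` the `6/5`-window of a
  site is the site plus the (zero, one or two) ALIGNED sites two layers up/down (`2h = 11/10`); the
  Hägg sequences `sUp` / `sDown` realise exactly one of them.  So the one-sided vertical dimer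
  `{x, x + (0,0,11/10)}` IS a Barlow window (`barlowMatched_of_dimer_up/_down`) and is NOT an hcp
  window (`not_hcpMatched_of_dimer`).
* §3 LOAD-BEARING HYPOTHESIS `IsGroundState`: `StackingFaultSparsityWithoutGroundState` (the crux
  with the ground-state hypothesis deleted, verbatim otherwise) is FALSE —
  `stackingFaultSparsity_false_without_groundState`, witness the dimer gas `dimerConfig`
  (`N/2` vertical dimers of length `11/10`, `10` apart): at `(R, ε) = (6/5, 1/100)` EVERY particle is
  Barlow-matched and none is hcp-matched, so the fraction is `1` for all even `N`.
  The other hypotheses `0 < R`, `0 < ε`, `ε < 1/4` are inert (dropping them only adds parameter values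
  at which the counted set is empty: `R < 0` or `ε < 0` ⇒ nothing/everything matched alike).
* §4 REFUTED NATURAL STRENGTHENING `SameScaleBarlowToHcp` ("at each fixed `(R, ε)`, Barlow windows
  a.e. ⇒ hcp windows a.e., for arbitrary configurations") — `not_sameScaleBarlowToHcp`, same witness.
  Message for the planner note S1 ("restate as `LaminarBarlowWindows → body`"): the transfer from
  Barlow windows to hcp windows cannot be made scale-by-scale and cannot be potential-free; it must use
  either Barlow order at LARGER scales than the conclusion (the dimer gas has no Barlow window at any
  `R ≥ 2`) or the energetics (`IsGroundState`).
* §5 VACUOUS REGIME: for `R ≤ ε` every particle of every configuration is hcp-matched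
  (`hcpMatched_of_le`, `card_bad_eq_zero_of_le`) — the crux has content only for `R > ε`.
* §6 NEAR-MISS (the only `sorry`): `not_allScaleBarlowToHcp` — the growing fcc crystals are
  Barlow-matched at every scale and hcp-matched at none with `R ≥ 1` (§7), so even ALL-SCALE Barlow
  order (the GS-free core of the conditional form `LaminarBarlowWindows → crux`) does not give the
  conclusion without energetics: a proof must certify `e(hcp) < e(fcc)`-type inequalities (Hägg
  domination).  Remaining obstruction after §7: only the surface count (`o(N)` lattice points of a ball
  lie within `R + 1` of its boundary) and the bookkeeping "interior sites are exactly Barlow-matched at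
  every `(R, ε)`" — routine, long; not attempted this cycle.
* §7 THE FCC FIRST SHELL IS COUNTED (proved): `not_hcpMatched_of_symmetric_shell` — a site with twelve
  pairwise `≥ 1`-separated particles at distance exactly `1`, closed under inversion, and nothing else
  strictly inside, is matched to NO relaxed hcp at `(R, ε) = (1, 1/100)` (centrosymmetry kills odd
  layers — `hcp_odd_layer_far`, inversion sends letter `B` to `C` —, and the even layers, a hexagonal
  Bravais lattice, offer only eight candidates `D8` for twelve model points — `hcp_even_census`);
  `cuboConfig_centre_counted` — the centre of the ideal 13-particle cuboctahedral cluster (fcc first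
  coordination shell, `fccQ` = the `A₃` form gives integral squared distances) is Barlow-matched and not
  hcp-matched at `(1, 1/100)`.  READING FOR THE CRUX: at `(R, ε) = (1, 1/100)` StackingFaultSparsity
  asserts in particular that fcc-coordinated (cuboctahedral, unit-scaled) sites have density `→ 0` in LJ
  ground states — stacking selection proper, which only the energy can deliver.

## Landed (all ACCEPTED 2026-08-16, `--supports stmt-AtomisticToContinuum-14296`, importable as
`Summits.AtomisticToContinuum.Crystallization.Theorems.StackingFaultSparsity.Negative.<Part>`,
namespace `Summit.AtomisticToContinuum.Crystallization.Theorems.StackingFaultSparsityNegative`)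
* part I `HcpTwin` (p129291, 4ae1147ba9e4): §0–§1;
* part II `BarlowWindow` (p129475, 3d3cef431501): §2;
* part III `DimerGas` (p129675, f13066fba8ae): §3–§5;
* part IV `HcpShellCensus` (p129522, b46326f067c2) and part V `Cuboctahedron` (p129735, d961218abf1a): §7.
This work file keeps a self-contained copy (namespace `…Cruxes.StackingFaultSparsity.Disproof`) plus the
near-miss §6; scratch checks should import the landed modules instead.

## What this says to provers / planners
1. The counted set at `(1, 1/100)` contains every (unit-scaled) fcc-coordinated site (§7); for ground
   states the crux therefore CONTAINS "cuboctahedral coordination is `o(N)` in LJ ground states" —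
   stacking selection proper, deliverable only by the energy (Hägg domination with certified
   couplings: items 3063 / 0737 / 12019, or truncation + Radin–Schulman periodicity).
2. A conditional restatement `X → StackingFaultSparsity` (planner note S1) must take `X` at scales
   LARGER than the conclusion's `R` — the same-scale transfer is false (§4) — and still needs
   energetics (§6).
3. Small `R` is harmless (§5; and `R` below the LJ minimal distance, rattack note 2026-08-15).

Everything except §6 is sorry-free; axioms `propext, Classical.choice, Quot.sound`.
-/

noncomputable section

namespace Summit.AtomisticToContinuum.Crystallization.Cruxes.StackingFaultSparsity.Disproof

open Literature.MathematicalPhysics.StatisticalMechanics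

/-! ## §0. The crux, parametrised -/

/-- Ambient space `ℝ³`. [folklore] -/
abbrev E3 : Type := EuclideanSpace ℝ (Fin 3)

/-- Particle `i` of `X` has its `R`-window two-way `ε`-matched, after the affine isometry
`p ↦ X i + A (p - z)`, to the window of the model set `S` at `z` (the matching predicate of the crux,
verbatim). [folklore] -/
def WindowMatched (R ε : ℝ) (S : Set E3) (z : E3) {N : ℕ} (X : Fin N → E3) (i : Fin N) : Prop :=
  ∃ A : E3 →ₗᵢ[ℝ] E3,
    (∀ p ∈ S, dist p z ≤ R → ∃ j : Fin N, dist (X j) (X i + A (p - z)) ≤ ε) ∧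
    (∀ j : Fin N, dist (X j) (X i) ≤ R → ∃ p ∈ S, dist (X j) (X i + A (p - z)) ≤ ε)

/-- `(R, ε)`-matched to SOME Barlow stacking with `a, h ∈ (1/2, 2)` (first conjunct of the crux's
counted predicate, verbatim). [folklore] -/
def BarlowMatched (R ε : ℝ) {N : ℕ} (X : Fin N → E3) (i : Fin N) : Prop :=
  ∃ a h : ℝ, 1 / 2 < a ∧ a < 2 ∧ 1 / 2 < h ∧ h < 2 ∧ ∃ s : ℤ → ℤ, IsHaggSeq s ∧
    ∃ z ∈ barlowStacking a h s, WindowMatched R ε (barlowStacking a h s) z X i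

/-- `(R, ε)`-matched to SOME `hcpStacking a h`, `a, h ∈ (1/2, 2)` (negated second conjunct of the
crux's counted predicate, verbatim). [folklore] -/
def HcpMatched (R ε : ℝ) {N : ℕ} (X : Fin N → E3) (i : Fin N) : Prop :=
  ∃ a h : ℝ, 1 / 2 < a ∧ a < 2 ∧ 1 / 2 < h ∧ h < 2 ∧
    ∃ z ∈ hcpStacking a h, WindowMatched R ε (hcpStacking a h) z X i

/-- The crux with the abbreviations, definitionally (`Iff.rfl`). [folklore] -/
theorem stackingFaultSparsity_iff :
    Summit.AtomisticToContinuum.Crystallization.Theses.SquareWellLayerCake.StackingFaultSparsity ↔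
      ∀ R ε : ℝ, 0 < R → 0 < ε → ε < 1 / 4 → ∀ x : (N : ℕ) → (Fin N → E3),
        (∀ N, IsGroundState lennardJones (x N)) →
        Filter.Tendsto (fun N : ℕ =>
          (Nat.card {i : Fin N // BarlowMatched R ε (x N) i ∧ ¬ HcpMatched R ε (x N) i} : ℝ) / N)
          Filter.atTop (nhds 0) :=
  Iff.rfl

/-- The shared item is literally one proposition in both route files. [folklore] -/
theorem stackingFaultSparsity_shared :
    Summit.AtomisticToContinuum.Crystallization.Theses.SquareWellLayerCake.StackingFaultSparsity ↔
      Summit.AtomisticToContinuum.Crystallization.Theses.LaminarSixThreeThree.StackingFaultSparsity :=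
  Iff.rfl

/-! ## §1. hcp windows are shell-paired -/

/-- **Twin lemma.** In `hcpStacking a h` (`0 < a`, `h ≠ 0`), every point `p ≠ z` has a twin
`p' ≠ p` in the stacking at the same distance from `z`: the basal mirror image through the layer of
`z` if `p` is off that layer (layers `k` and `2k₀ - k` carry the same letter in `ABAB…`), the in-layer
inversion `2z - p` otherwise. Hence punctured hcp windows carry a fixed-point-free distance-preserving
involution — the obstruction behind every "Barlow but not hcp" witness below. [new] -/
theorem hcp_twin {a h : ℝ} (ha : 0 < a) (hh : h ≠ 0) {z p : E3}
    (hz : z ∈ hcpStacking a h) (hp : p ∈ hcpStacking a h) (hpz : p ≠ z) :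
    ∃ p' ∈ hcpStacking a h, p' ≠ p ∧ dist p' z = dist p z := by
  obtain ⟨k₀, i₀, j₀, rfl⟩ := hz
  obtain ⟨k, i, j, rfl⟩ := hp
  by_cases hk : k = k₀
  · subst hk
    refine ⟨barlowPos a h alternatingHagg k (2 * i₀ - i) (2 * j₀ - j), barlowPos_mem _ _ _, ?_, ?_⟩
    · intro heq
      have hne : ((2 * i₀ - i, 2 * j₀ - j) : ℤ × ℤ) ≠ (i, j) := by
        intro h0
        simp only [Prod.mk.injEq] at h0
        obtain ⟨rfl, rfl⟩ : i = i₀ ∧ j = j₀ := ⟨by omega, by omega⟩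
        exact hpz rfl
      have := le_dist_barlowPos_of_ne a h alternatingHagg (k := k) ha.le hne
      rw [heq, dist_self] at this
      linarith
    · rw [← Real.sqrt_sq (dist_nonneg (x := barlowPos a h alternatingHagg k (2 * i₀ - i) (2 * j₀ - j))
        (y := barlowPos a h alternatingHagg k i₀ j₀)), ← Real.sqrt_sq (dist_nonneg
        (x := barlowPos a h alternatingHagg k i j) (y := barlowPos a h alternatingHagg k i₀ j₀)),
        dist_barlowPos_sq, dist_barlowPos_sq]
      congr 1
      push_cast
      ring
  · refine ⟨barlowPos a h alternatingHagg (2 * k₀ - k) i j, barlowPos_mem _ _ _, ?_, ?_⟩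
    · intro heq
      have := congrArg (fun x : E3 => x 2) heq
      simp only [barlowPos_apply_two] at this
      push_cast at this
      have : ((k₀ : ℝ) - k) * h = 0 := by linarith
      rcases mul_eq_zero.1 this with h1 | h1
      · exact hk (by exact_mod_cast (sub_eq_zero.1 h1).symm)
      · exact hh h1
    · have hL : haggLabel alternatingHagg (2 * k₀ - k) = haggLabel alternatingHagg k := by
        rw [haggLabel_alternating, haggLabel_alternating]
        have : Even (2 * k₀ - k) ↔ Even k := by
          rw [Int.even_sub]
          simp
        simp only [this]
      rw [← Real.sqrt_sq (dist_nonneg (x := barlowPos a h alternatingHagg (2 * k₀ - k) i j)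
        (y := barlowPos a h alternatingHagg k₀ i₀ j₀)), ← Real.sqrt_sq (dist_nonneg
        (x := barlowPos a h alternatingHagg k i j) (y := barlowPos a h alternatingHagg k₀ i₀ j₀)),
        dist_barlowPos_sq, dist_barlowPos_sq, hL]
      congr 1
      push_cast
      ring

/-- **Dimer windows are not hcp windows.** If the only particles within distance `10` of `X i` sit
at `X i` itself or at one partner site `X j₀` with `dist (X j₀) (X i) = 11/10`, then the `6/5`-window
of `i` is matched to no `hcpStacking a h`, `a, h ∈ (1/2, 2)`, at tolerance `1/100`: the partner's model
point has a twin at the same distance from the centre (`hcp_twin`), the particle within `1/100` of the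
twin's image can only be the partner again, and then two distinct stacking points are within `1/50`
of each other, against uniform discreteness `min a h > 1/2`. [new] -/
theorem not_hcpMatched_of_dimer {N : ℕ} (X : Fin N → E3) (i j₀ : Fin N)
    (hq : dist (X j₀) (X i) = 11 / 10)
    (hiso : ∀ j : Fin N, dist (X j) (X i) < 10 → X j = X i ∨ X j = X j₀) :
    ¬ HcpMatched (6 / 5) (1 / 100) X i := by
  rintro ⟨a, h, ha1, -, hh1, -, z, hz, A, h1, h2⟩
  obtain ⟨p, hp, hpd⟩ := h2 j₀ (by rw [hq]; norm_num)
  have hv : ‖A (p - z)‖ = dist p z := by rw [LinearIsometry.norm_map, dist_eq_norm]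
  have hv1 : dist (X i + A (p - z)) (X i) = dist p z := by
    rw [dist_eq_norm, add_sub_cancel_left, hv]
  have hpz_lo : 109 / 100 ≤ dist p z := by
    have := dist_triangle (X j₀) (X i + A (p - z)) (X i)
    linarith
  have hpz_hi : dist p z ≤ 111 / 100 := by
    have := dist_triangle (X i + A (p - z)) (X j₀) (X i)
    rw [dist_comm (X i + A (p - z)) (X j₀)] at this
    linarith
  have hpz : p ≠ z := by
    rintro rfl
    rw [dist_self] at hpz_lo
    linarith
  have ha0 : (0 : ℝ) < a := by linarith
  have hh0 : h ≠ 0 := by rintro rfl; linarith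
  obtain ⟨q, hqS, hne, hdist⟩ := hcp_twin ha0 hh0 hz hp hpz
  obtain ⟨j, hj⟩ := h1 q hqS (by rw [hdist]; linarith)
  have hw : ‖A (q - z)‖ = dist p z := by rw [LinearIsometry.norm_map, ← dist_eq_norm, hdist]
  have hw1 : dist (X i + A (q - z)) (X i) = dist p z := by
    rw [dist_eq_norm, add_sub_cancel_left, hw]
  have hjd : dist (X j) (X i) < 10 := by
    have := dist_triangle (X j) (X i + A (q - z)) (X i)
    linarith
  rcases hiso j hjd with hji | hjj
  · rw [hji, dist_comm] at hj
    linarith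
  · rw [hjj] at hj
    have hpq : dist p q ≤ 1 / 50 := by
      have h3 := dist_triangle (X i + A (p - z)) (X j₀) (X i + A (q - z))
      rw [dist_comm (X i + A (p - z)) (X j₀), dist_add_left, LinearIsometry.dist_map,
        dist_sub_right] at h3
      linarith
    have hmin := le_dist_of_mem_barlowStacking a h alternatingHagg ha0.le (by linarith) hp hqS hne.symm
    have : (1 : ℝ) / 2 < min a h := lt_min ha1 hh1
    linarith

/-! ## §2. Windows of radius `6/5` in Barlow stackings with `a = 199/100`, `h = 11/20` -/

/-- Parity lemma: integers `X ≡ Y (mod 2)`, not both zero, have `3X² + Y² ≥ 4`. [folklore] -/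
theorem four_le_of_parity {X Y : ℤ} (hpar : Even (X - Y)) (hne : (X, Y) ≠ 0) :
    4 ≤ 3 * X ^ 2 + Y ^ 2 := by
  rcases Int.even_or_odd Y with ⟨t, rfl⟩ | ⟨t, rfl⟩
  · have hX : Even X := by
      have : X = (X - (t + t)) + (t + t) := by ring
      rw [this]; exact hpar.add ⟨t, rfl⟩
    obtain ⟨u, rfl⟩ := hX
    by_cases ht : t = 0
    · subst ht
      have hu : u ≠ 0 := by rintro rfl; exact hne (by simp)
      have : 0 < u ^ 2 := by positivity
      nlinarith
    · have : 0 < t ^ 2 := by positivity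
      nlinarith
  · have hX : Odd X := by
      have : X = (X - (2 * t + 1)) + (2 * t + 1) := by ring
      rw [this]; exact hpar.add_odd ⟨t, rfl⟩
    obtain ⟨u, rfl⟩ := hX
    have hu : 0 ≤ u * (u + 1) := by
      rcases le_or_gt 0 u with h0 | h0
      · positivity
      · have h1 : u + 1 ≤ 0 := by omega
        exact mul_nonneg_of_nonpos_of_nonpos h0.le h1
    have ht : 0 ≤ t * (t + 1) := by
      rcases le_or_gt 0 t with h0 | h0
      · positivity
      · have h1 : t + 1 ≤ 0 := by omega
        exact mul_nonneg_of_nonpos_of_nonpos h0.le h1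
    have key : 3 * (2 * u + 1) ^ 2 + (2 * t + 1) ^ 2 =
        12 * (u * (u + 1)) + 4 * (t * (t + 1)) + 4 := by ring
    rw [key]
    linarith

/-- Squared distance to the origin site of layer `0` in the integer coordinates `X = 2i + j + L`,
`Y = 3j + L` (`L` the label of layer `k`): `a² (3X² + Y²)/12 + (k h)²`. [folklore] -/
theorem dist_barlowPos_origin_sq (a h : ℝ) (s : ℤ → ℤ) (k i j : ℤ) :
    dist (barlowPos a h s k i j) (barlowPos a h s 0 0 0) ^ 2 =
      a ^ 2 * (3 * (2 * i + j + haggLabel s k) ^ 2 + (3 * j + haggLabel s k) ^ 2 : ℤ) / 12 +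
        (k * h) ^ 2 := by
  rw [dist_barlowPos_sq]
  have h3 : (√3 : ℝ) ^ 2 = 3 := Real.sq_sqrt (by norm_num)
  simp only [haggLabel_zero, Int.cast_zero, sub_zero]
  push_cast
  linear_combination (a ^ 2 * (3 * j + haggLabel s k) ^ 2 / 36) * h3

/-- **Window census at `(a, h, R) = (199/100, 11/20, 6/5)`, any Hägg sequence.** A stacking point
within `6/5` of a site is the site itself or lies straight above/below it TWO layers away
(`i = j = -L/3`, which requires those layers to be aligned, `3 ∣ L`): in-layer points are `≥ a`
away, adjacent-layer points `≥ √(a²/3 + h²) > 6/5`, non-aligned second layers `≥ √(a²/3 + 4h²)`,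
third layers `≥ 3h > 6/5` (lateral offsets in a Barlow stacking are `0` or `≥ a/√3`, by
`four_le_of_parity`). [new] -/
theorem window_cases {s : ℤ → ℤ} (hs : IsHaggSeq s) {k i j : ℤ}
    (hd : dist (barlowPos (199 / 100) (11 / 20) s k i j) (barlowPos (199 / 100) (11 / 20) s 0 0 0)
      ≤ 6 / 5) :
    (k = 0 ∧ i = 0 ∧ j = 0) ∨ ((k = 2 ∨ k = -2) ∧ haggLabel s k = -3 * j ∧ i = j) := by
  have hsq := dist_barlowPos_origin_sq (199 / 100) (11 / 20) s k i j
  set L := haggLabel s k with hLdef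
  set Q : ℤ := 3 * (2 * i + j + L) ^ 2 + (3 * j + L) ^ 2 with hQ
  have hd2 : dist (barlowPos (199 / 100) (11 / 20) s k i j) (barlowPos (199 / 100) (11 / 20) s 0 0 0)
      ^ 2 ≤ (6 / 5) ^ 2 := by gcongr
  rw [hsq] at hd2
  have hQnn : (0 : ℤ) ≤ Q := by positivity
  have hQnn' : (0 : ℝ) ≤ (Q : ℝ) := by exact_mod_cast hQnn
  have hk2 : k ^ 2 ≤ 4 := by
    by_contra hk
    have hk5 : (5 : ℤ) ≤ k ^ 2 := by
      push Not at hk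
      have : 4 < k ^ 2 := hk
      omega
    have : (5 : ℝ) ≤ (k : ℝ) ^ 2 := by exact_mod_cast hk5
    nlinarith
  have hQ0 : Q = 0 := by
    by_contra hQne
    have hXY : ((2 * i + j + L, 3 * j + L) : ℤ × ℤ) ≠ 0 := by
      intro h0
      rw [Prod.mk_eq_zero] at h0
      apply hQne
      rw [hQ, h0.1, h0.2]; norm_num
    have h4 : 4 ≤ Q := four_le_of_parity ⟨i - j, by ring⟩ hXY
    have h4' : (4 : ℝ) ≤ (Q : ℝ) := by exact_mod_cast h4
    have hk0 : k = 0 := by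
      by_contra hk0
      have : (1 : ℤ) ≤ k ^ 2 := by
        have : 0 < k ^ 2 := by positivity
        omega
      have : (1 : ℝ) ≤ (k : ℝ) ^ 2 := by exact_mod_cast this
      nlinarith
    have hL0 : L = 0 := by rw [hLdef, hk0, haggLabel_zero]
    have hij : ((i, j) : ℤ × ℤ) ≠ 0 := by
      intro h0
      rw [Prod.mk_eq_zero] at h0
      apply hXY
      rw [h0.1, h0.2, hL0]; norm_num
    have h12 : 12 ≤ Q := by
      have := one_le_sq_add_mul_add_sq hij
      rw [hQ, hL0]; nlinarith
    have h12' : (12 : ℝ) ≤ (Q : ℝ) := by exact_mod_cast h12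
    nlinarith
  have hY : 3 * j + L = 0 := by
    by_contra hY
    have : 0 < (3 * j + L) ^ 2 := by positivity
    have : 0 ≤ 3 * (2 * i + j + L) ^ 2 := by positivity
    omega
  have hX : 2 * i + j + L = 0 := by
    by_contra hX
    have : 0 < (2 * i + j + L) ^ 2 := by positivity
    have : 0 ≤ (3 * j + L) ^ 2 := by positivity
    omega
  have hLj : L = -3 * j := by omega
  have hij : i = j := by omega
  have hk : k = 0 ∨ k = 1 ∨ k = -1 ∨ k = 2 ∨ k = -2 := by
    have : -2 ≤ k ∧ k ≤ 2 := by
      constructor <;> nlinarith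
    omega
  rcases hk with rfl | rfl | rfl | rfl | rfl
  · left
    have : L = 0 := by rw [hLdef, haggLabel_zero]
    exact ⟨rfl, by omega, by omega⟩
  · exfalso
    have h1 : haggLabel s 1 = s 0 := by
      have := haggLabel_succ s 0
      simpa using this
    rcases hs 0 with h0 | h0 <;> omega
  · exfalso
    have h1 : haggLabel s (-1) = -s (-1) := by
      have := haggLabel_succ s (-1)
      simp at this
      linarith
    rcases hs (-1) with h0 | h0 <;> omega
  · right; exact ⟨Or.inl rfl, hLj, hij⟩
  · right; exact ⟨Or.inr rfl, hLj, hij⟩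

/-- The origin site of any stacking is the origin. [folklore] -/
theorem barlowPos_zero (a h : ℝ) (s : ℤ → ℤ) : barlowPos a h s 0 0 0 = 0 := by
  ext l
  fin_cases l <;> simp

/-- Hägg sequence `…, +, +, +, (− at 1), +, …`: around layer `0` the letters are `B C A B A` —
layers `0` and `2` aligned, `0` and `−2` not. [new] -/
def sUp : ℤ → ℤ := fun m => if m = 1 then -1 else 1

/-- Hägg sequence with `−` at `−1` only: letters `A B A B C` around layer `0` — layers `0` and `−2`
aligned, `0` and `2` not. [new] -/
def sDown : ℤ → ℤ := fun m => if m = -1 then -1 else 1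

/-- `sUp` is a Hägg sequence. [folklore] -/
theorem isHaggSeq_sUp : IsHaggSeq sUp := fun m => by unfold sUp; split_ifs <;> simp

/-- `sDown` is a Hägg sequence. [folklore] -/
theorem isHaggSeq_sDown : IsHaggSeq sDown := fun m => by unfold sDown; split_ifs <;> simp

/-- Layer `2` of `sUp` is aligned with layer `0`. [folklore] -/
theorem haggLabel_sUp_two : haggLabel sUp 2 = 0 := by
  rw [show (2 : ℤ) = ((2 : ℕ) : ℤ) by rfl, haggLabel_natCast]
  simp [haggWindow, Finset.sum_range_succ, sUp]

/-- Layer `−2` of `sUp` is not aligned with layer `0`. [folklore] -/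
theorem haggLabel_sUp_neg_two : haggLabel sUp (-2) = -2 := by
  rw [show (-2 : ℤ) = -((2 : ℕ) : ℤ) by rfl, haggLabel_neg_natCast]
  simp [haggWindow, Finset.sum_range_succ, sUp]

/-- Layer `2` of `sDown` is not aligned with layer `0`. [folklore] -/
theorem haggLabel_sDown_two : haggLabel sDown 2 = 2 := by
  rw [show (2 : ℤ) = ((2 : ℕ) : ℤ) by rfl, haggLabel_natCast]
  simp [haggWindow, sDown]

/-- Layer `−2` of `sDown` is aligned with layer `0`. [folklore] -/
theorem haggLabel_sDown_neg_two : haggLabel sDown (-2) = 0 := by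
  rw [show (-2 : ℤ) = -((2 : ℕ) : ℤ) by rfl, haggLabel_neg_natCast]
  simp [haggWindow, Finset.sum_range_succ, sDown]

/-- The aligned site two layers above the origin of `sUp` is `(0, 0, 11/10)`. [folklore] -/
theorem barlowPos_sUp_two :
    barlowPos (199 / 100) (11 / 20) sUp 2 0 0 = !₂[0, 0, 11 / 10] := by
  ext l
  fin_cases l
  · simp [haggLabel_sUp_two]
  · simp [haggLabel_sUp_two]
  · simp; norm_num

/-- The aligned site two layers below the origin of `sDown` is `(0, 0, −11/10)`. [folklore] -/
theorem barlowPos_sDown_neg_two :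
    barlowPos (199 / 100) (11 / 20) sDown (-2) 0 0 = !₂[0, 0, -(11 / 10)] := by
  ext l
  fin_cases l
  · simp [haggLabel_sDown_neg_two]
  · simp [haggLabel_sDown_neg_two]
  · simp; norm_num

/-- **An upward dimer is a Barlow window.** If `X j₀ = X i + (0, 0, 11/10)` and the only particles
within `10` of `X i` sit at `X i` or `X j₀`, then `i` is `(6/5, 1/100)`-matched (indeed exactly) to
the stacking of `sUp` with `a = 199/100`, `h = 11/20`, centred at its origin, `A = id`. [new] -/
theorem barlowMatched_of_dimer_up {N : ℕ} (X : Fin N → E3) (i j₀ : Fin N)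
    (hq : X j₀ = X i + !₂[0, 0, 11 / 10])
    (hiso : ∀ j : Fin N, dist (X j) (X i) < 10 → X j = X i ∨ X j = X j₀) :
    BarlowMatched (6 / 5) (1 / 100) X i := by
  refine ⟨199 / 100, 11 / 20, by norm_num, by norm_num, by norm_num, by norm_num, sUp, isHaggSeq_sUp,
    barlowPos (199 / 100) (11 / 20) sUp 0 0 0, barlowPos_mem _ _ _, LinearIsometry.id, ?_, ?_⟩
  · rintro p ⟨k, i', j', rfl⟩ hpd
    rcases window_cases isHaggSeq_sUp hpd with ⟨rfl, rfl, rfl⟩ | ⟨hk, hL, hij⟩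
    · exact ⟨i, by simp⟩
    · rcases hk with rfl | rfl
      · rw [haggLabel_sUp_two] at hL
        obtain rfl : j' = 0 := by omega
        obtain rfl : i' = 0 := by omega
        refine ⟨j₀, ?_⟩
        rw [hq, barlowPos_zero, sub_zero, barlowPos_sUp_two]
        simp
      · rw [haggLabel_sUp_neg_two] at hL
        omega
  · intro j hj
    rcases hiso j (by linarith) with hji | hjj
    · exact ⟨_, barlowPos_mem 0 0 0, by rw [hji]; simp⟩
    · refine ⟨_, barlowPos_mem 2 0 0, ?_⟩
      rw [hjj, hq, barlowPos_zero, sub_zero, barlowPos_sUp_two]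
      simp

/-- **A downward dimer is a Barlow window** (stacking of `sDown`). [new] -/
theorem barlowMatched_of_dimer_down {N : ℕ} (X : Fin N → E3) (i j₀ : Fin N)
    (hq : X j₀ = X i + !₂[0, 0, -(11 / 10)])
    (hiso : ∀ j : Fin N, dist (X j) (X i) < 10 → X j = X i ∨ X j = X j₀) :
    BarlowMatched (6 / 5) (1 / 100) X i := by
  refine ⟨199 / 100, 11 / 20, by norm_num, by norm_num, by norm_num, by norm_num, sDown,
    isHaggSeq_sDown, barlowPos (199 / 100) (11 / 20) sDown 0 0 0, barlowPos_mem _ _ _,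
    LinearIsometry.id, ?_, ?_⟩
  · rintro p ⟨k, i', j', rfl⟩ hpd
    rcases window_cases isHaggSeq_sDown hpd with ⟨rfl, rfl, rfl⟩ | ⟨hk, hL, hij⟩
    · exact ⟨i, by simp⟩
    · rcases hk with rfl | rfl
      · rw [haggLabel_sDown_two] at hL
        omega
      · rw [haggLabel_sDown_neg_two] at hL
        obtain rfl : j' = 0 := by omega
        obtain rfl : i' = 0 := by omega
        refine ⟨j₀, ?_⟩
        rw [hq, barlowPos_zero, sub_zero, barlowPos_sDown_neg_two]
        simp
  · intro j hj
    rcases hiso j (by linarith) with hji | hjj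
    · exact ⟨_, barlowPos_mem 0 0 0, by rw [hji]; simp⟩
    · refine ⟨_, barlowPos_mem (-2) 0 0, ?_⟩
      rw [hjj, hq, barlowPos_zero, sub_zero, barlowPos_sDown_neg_two]
      simp

/-- **An isolated particle is a Barlow window** (and equally an hcp window): with `a = h = 199/100`
the `6/5`-window of a site is the site alone. [folklore] -/
theorem barlowMatched_of_isolated {N : ℕ} (X : Fin N → E3) (i : Fin N)
    (hiso : ∀ j : Fin N, dist (X j) (X i) < 10 → X j = X i) :
    BarlowMatched (6 / 5) (1 / 100) X i := by
  refine ⟨199 / 100, 199 / 100, by norm_num, by norm_num, by norm_num, by norm_num, constHagg,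
    isHaggSeq_const, barlowPos (199 / 100) (199 / 100) constHagg 0 0 0, barlowPos_mem _ _ _,
    LinearIsometry.id, ?_, ?_⟩
  · intro p hp hpd
    refine ⟨i, ?_⟩
    have : p = barlowPos (199 / 100) (199 / 100) constHagg 0 0 0 := by
      by_contra hne
      have := le_dist_of_mem_barlowStacking (199 / 100) (199 / 100) constHagg (by norm_num)
        (by norm_num) hp (barlowPos_mem 0 0 0) hne
      rw [min_self] at this
      linarith
    rw [this]
    simp
  · intro j hj
    refine ⟨_, barlowPos_mem 0 0 0, ?_⟩
    rw [hiso j (by linarith)]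
    simp

/-! ## §3. The ground-state hypothesis is load-bearing: the dimer gas -/

/-- Site `n` of the dimer gas: `(10 ⌊n/2⌋, 0, 11/10 · (n mod 2))` — particles `2m`, `2m+1` form a
vertical dimer of length `11/10`, consecutive dimers are `10` apart. [new] -/
def dimerPos (n : ℕ) : E3 := !₂[10 * ((n / 2 : ℕ) : ℝ), 0, 11 / 10 * ((n % 2 : ℕ) : ℝ)]

/-- The dimer gas with `N` particles (the first `N` sites). [new] -/
def dimerConfig (N : ℕ) : Fin N → E3 := fun i => dimerPos i

/-- The upper site of a dimer is the lower one plus `(0, 0, 11/10)`. [folklore] -/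
theorem dimerPos_succ_of_even {n : ℕ} (hn : n % 2 = 0) :
    dimerPos (n + 1) = dimerPos n + !₂[0, 0, 11 / 10] := by
  have h1 : (n + 1) / 2 = n / 2 := by omega
  have h2 : (n + 1) % 2 = 1 := by omega
  ext l
  fin_cases l <;> simp [dimerPos, h1, h2, hn]

/-- Sites of different dimers are `≥ 10` apart (first coordinate). [folklore] -/
theorem div_two_eq_of_dist_lt {n n' : ℕ} (h : dist (dimerPos n') (dimerPos n) < 10) :
    n' / 2 = n / 2 := by
  by_contra hne
  have e0 : ∀ m : ℕ, (dimerPos m) 0 = 10 * ((m / 2 : ℕ) : ℝ) := fun m => by simp [dimerPos]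
  have h0 := PiLp.dist_apply_le (dimerPos n') (dimerPos n) 0
  rw [Real.dist_eq, e0, e0, ← mul_sub, abs_mul, abs_of_pos (by norm_num : (0 : ℝ) < 10)] at h0
  have h1 : (1 : ℝ) ≤ |((n' / 2 : ℕ) : ℝ) - ((n / 2 : ℕ) : ℝ)| := by
    rcases Nat.lt_or_gt_of_ne hne with hlt | hlt
    · have : ((n' / 2 : ℕ) : ℝ) + 1 ≤ ((n / 2 : ℕ) : ℝ) := by exact_mod_cast hlt
      rw [abs_sub_comm, abs_of_nonneg (by linarith)]
      linarith
    · have : ((n / 2 : ℕ) : ℝ) + 1 ≤ ((n' / 2 : ℕ) : ℝ) := by exact_mod_cast hlt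
      rw [abs_of_nonneg (by linarith)]
      linarith
  linarith

/-- **Every paired particle of the dimer gas is Barlow-matched and not hcp-matched** at
`(R, ε) = (6/5, 1/100)`. [new] -/
theorem dimer_bad {N : ℕ} (i : Fin N) (hpart : (i : ℕ) / 2 * 2 + 1 < N) :
    BarlowMatched (6 / 5) (1 / 100) (dimerConfig N) i ∧
      ¬ HcpMatched (6 / 5) (1 / 100) (dimerConfig N) i := by
  rcases Nat.even_or_odd (i : ℕ) with he | ho
  · -- lower particle, partner i + 1
    have hn : (i : ℕ) % 2 = 0 := Nat.even_iff.mp he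
    have hlt : (i : ℕ) + 1 < N := by omega
    set j₀ : Fin N := ⟨(i : ℕ) + 1, hlt⟩ with hj₀
    have hq : dimerConfig N j₀ = dimerConfig N i + !₂[0, 0, 11 / 10] := by
      simp only [dimerConfig, hj₀]
      exact dimerPos_succ_of_even hn
    have hiso : ∀ j : Fin N, dist (dimerConfig N j) (dimerConfig N i) < 10 →
        dimerConfig N j = dimerConfig N i ∨ dimerConfig N j = dimerConfig N j₀ := by
      intro j hj
      have hjj := div_two_eq_of_dist_lt hj
      have : (j : ℕ) = i ∨ (j : ℕ) = i + 1 := by omega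
      rcases this with h0 | h0
      · left; simp only [dimerConfig, h0]
      · right; simp only [dimerConfig, h0, hj₀]
    refine ⟨barlowMatched_of_dimer_up _ i j₀ hq hiso, not_hcpMatched_of_dimer _ i j₀ ?_ hiso⟩
    rw [hq, dist_comm, dist_eq_norm]
    simp [EuclideanSpace.norm_eq, Fin.sum_univ_three]
    norm_num
  · -- upper particle, partner i - 1
    have hn : (i : ℕ) % 2 = 1 := Nat.odd_iff.mp ho
    have hlt : (i : ℕ) - 1 < N := by omega
    set j₀ : Fin N := ⟨(i : ℕ) - 1, hlt⟩ with hj₀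
    have hq' : dimerConfig N i = dimerConfig N j₀ + !₂[0, 0, 11 / 10] := by
      simp only [dimerConfig, hj₀]
      have h0 : (i : ℕ) = ((i : ℕ) - 1) + 1 := by omega
      conv_lhs => rw [h0]
      exact dimerPos_succ_of_even (by omega)
    have hq : dimerConfig N j₀ = dimerConfig N i + !₂[0, 0, -(11 / 10)] := by
      rw [hq', add_assoc]
      have : (!₂[0, 0, 11 / 10] : E3) + !₂[0, 0, -(11 / 10)] = 0 := by
        ext l; fin_cases l <;> simp
      rw [this, add_zero]
    have hiso : ∀ j : Fin N, dist (dimerConfig N j) (dimerConfig N i) < 10 →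
        dimerConfig N j = dimerConfig N i ∨ dimerConfig N j = dimerConfig N j₀ := by
      intro j hj
      have hjj := div_two_eq_of_dist_lt hj
      have : (j : ℕ) = i ∨ (j : ℕ) = i - 1 := by omega
      rcases this with h0 | h0
      · left; simp only [dimerConfig, h0]
      · right; simp only [dimerConfig, h0, hj₀]
    refine ⟨barlowMatched_of_dimer_down _ i j₀ hq hiso, not_hcpMatched_of_dimer _ i j₀ ?_ hiso⟩
    rw [hq, dist_comm, dist_eq_norm]
    simp [EuclideanSpace.norm_eq, Fin.sum_univ_three]
    norm_num

/-- For even `N` every particle of the dimer gas is counted. [new] -/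
theorem card_bad_even (M : ℕ) :
    Nat.card {i : Fin (2 * M) // BarlowMatched (6 / 5) (1 / 100) (dimerConfig (2 * M)) i ∧
      ¬ HcpMatched (6 / 5) (1 / 100) (dimerConfig (2 * M)) i} = 2 * M := by
  have hall : ∀ i : Fin (2 * M), BarlowMatched (6 / 5) (1 / 100) (dimerConfig (2 * M)) i ∧
      ¬ HcpMatched (6 / 5) (1 / 100) (dimerConfig (2 * M)) i :=
    fun i => dimer_bad i (by have := i.isLt; omega)
  rw [Nat.card_congr (Equiv.subtypeUnivEquiv hall), Nat.card_eq_fintype_card, Fintype.card_fin]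

/-- The crux WITHOUT the hypothesis `∀ N, IsGroundState lennardJones (x N)` (verbatim otherwise):
the counted fraction should vanish for EVERY sequence of configurations. [new] -/
def StackingFaultSparsityWithoutGroundState : Prop :=
  ∀ R ε : ℝ, 0 < R → 0 < ε → ε < 1 / 4 → ∀ x : (N : ℕ) → (Fin N → EuclideanSpace ℝ (Fin 3)), Filter.Tendsto (fun N : ℕ => (Nat.card {i : Fin N // (∃ a h : ℝ, 1 / 2 < a ∧ a < 2 ∧ 1 / 2 < h ∧ h < 2 ∧ ∃ s : ℤ → ℤ, Literature.MathematicalPhysics.StatisticalMechanics.IsHaggSeq s ∧ ∃ z ∈ Literature.MathematicalPhysics.StatisticalMechanics.barlowStacking a h s, ∃ A : EuclideanSpace ℝ (Fin 3) →ₗᵢ[ℝ] EuclideanSpace ℝ (Fin 3), (∀ p ∈ Literature.MathematicalPhysics.StatisticalMechanics.barlowStacking a h s, dist p z ≤ R → ∃ j : Fin N, dist (x N j) (x N i + A (p - z)) ≤ ε) ∧ (∀ j : Fin N, dist (x N j) (x N i) ≤ R → ∃ p ∈ Literature.MathematicalPhysics.StatisticalMechanics.barlowStacking a h s, dist (x N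 j) (x N i + A (p - z)) ≤ ε)) ∧ ¬ (∃ a h : ℝ, 1 / 2 < a ∧ a < 2 ∧ 1 / 2 < h ∧ h < 2 ∧ ∃ z ∈ Literature.MathematicalPhysics.StatisticalMechanics.hcpStacking a h, ∃ A : EuclideanSpace ℝ (Fin 3) →ₗᵢ[ℝ] EuclideanSpace ℝ (Fin 3), (∀ p ∈ Literature.MathematicalPhysics.StatisticalMechanics.hcpStacking a h, dist p z ≤ R → ∃ j : Fin N, dist (x N j) (x N i + A (p - z)) ≤ ε) ∧ (∀ j : Fin N, dist (x N j) (x N i) ≤ R → ∃ p ∈ Literature.MathematicalPhysics.StatisticalMechanics.hcpStacking a h, dist (x N j) (x N i + A (p - z)) ≤ ε))} : ℝ) / N) Filter.atTop (nhds 0)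

/-- The GS-free statement with the abbreviations (`Iff.rfl`). [folklore] -/
theorem stackingFaultSparsityWithoutGroundState_iff :
    StackingFaultSparsityWithoutGroundState ↔
      ∀ R ε : ℝ, 0 < R → 0 < ε → ε < 1 / 4 → ∀ x : (N : ℕ) → (Fin N → E3),
        Filter.Tendsto (fun N : ℕ =>
          (Nat.card {i : Fin N // BarlowMatched R ε (x N) i ∧ ¬ HcpMatched R ε (x N) i} : ℝ) / N)
          Filter.atTop (nhds 0) :=
  Iff.rfl

/-- Along even `N` the counted fraction of the dimer gas is identically `1`, so it does not tend
to `0`. [new] -/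
theorem not_tendsto_dimerConfig :
    ¬ Filter.Tendsto (fun N : ℕ =>
        (Nat.card {i : Fin N // BarlowMatched (6 / 5) (1 / 100) (dimerConfig N) i ∧
          ¬ HcpMatched (6 / 5) (1 / 100) (dimerConfig N) i} : ℝ) / N)
        Filter.atTop (nhds 0) := by
  intro h
  have hsub : Filter.Tendsto (fun M : ℕ => 2 * (M + 1)) Filter.atTop Filter.atTop :=
    Filter.tendsto_atTop_atTop.2 fun b => ⟨b, fun M hM => by omega⟩
  have h2 := h.comp hsub
  have h3 : (fun N : ℕ =>
        (Nat.card {i : Fin N // BarlowMatched (6 / 5) (1 / 100) (dimerConfig N) i ∧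
          ¬ HcpMatched (6 / 5) (1 / 100) (dimerConfig N) i} : ℝ) / N) ∘ (fun M : ℕ => 2 * (M + 1)) =
      fun _ => (1 : ℝ) := by
    funext M
    simp only [Function.comp_apply]
    rw [card_bad_even (M + 1)]
    have : ((2 * (M + 1) : ℕ) : ℝ) ≠ 0 := by positivity
    exact div_self this
  rw [h3] at h2
  have := tendsto_nhds_unique h2 tendsto_const_nhds
  norm_num at this

/-- **`IsGroundState` is load-bearing: the crux with the ground-state hypothesis dropped is false.**
Witness: the dimer gas at `(R, ε) = (6/5, 1/100)`. So no argument about Barlow/hcp windows that is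
blind to the energy (or to Barlow order at larger scales) can prove the crux. [new] -/
theorem stackingFaultSparsity_false_without_groundState : ¬ StackingFaultSparsityWithoutGroundState := by
  rw [stackingFaultSparsityWithoutGroundState_iff]
  intro H
  exact not_tendsto_dimerConfig (H (6 / 5) (1 / 100) (by norm_num) (by norm_num) (by norm_num) dimerConfig)

/-! ## §4. A refuted strengthening: no scale-by-scale transfer from Barlow to hcp windows -/

/-- Every particle of the dimer gas (paired or, for odd `N`, the last unpaired one) is
Barlow-matched at `(6/5, 1/100)`. [new] -/
theorem dimerConfig_barlowMatched {N : ℕ} (i : Fin N) :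
    BarlowMatched (6 / 5) (1 / 100) (dimerConfig N) i := by
  by_cases hpart : (i : ℕ) / 2 * 2 + 1 < N
  · exact (dimer_bad i hpart).1
  · apply barlowMatched_of_isolated
    intro j hj
    have hjj := div_two_eq_of_dist_lt hj
    have h1 := j.isLt
    have h2 := i.isLt
    have : (j : ℕ) = i := by omega
    simp only [dimerConfig, this]

/-- SAME-SCALE TRANSFER (a natural strengthening / the naive conditional form of the crux): at each
fixed `(R, ε)`, for EVERY sequence of configurations, "all but `o(N)` particles have a Barlow
`(R, ε)`-window" implies "all but `o(N)` of the Barlow-matched particles have an hcp `(R, ε)`-window".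
[new] -/
def SameScaleBarlowToHcp : Prop :=
  ∀ R ε : ℝ, 0 < R → 0 < ε → ε < 1 / 4 → ∀ x : (N : ℕ) → (Fin N → E3),
    Filter.Tendsto (fun N : ℕ => (Nat.card {i : Fin N // ¬ BarlowMatched R ε (x N) i} : ℝ) / N)
      Filter.atTop (nhds 0) →
    Filter.Tendsto (fun N : ℕ =>
      (Nat.card {i : Fin N // BarlowMatched R ε (x N) i ∧ ¬ HcpMatched R ε (x N) i} : ℝ) / N)
      Filter.atTop (nhds 0)

/-- **The same-scale transfer is false** (dimer gas: no particle lacks a Barlow `(6/5,1/100)`-window,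
all paired particles lack an hcp one).  Hence a conditional restatement `X → StackingFaultSparsity`
must feed in Barlow order at scales LARGER than the conclusion's `R` (as `LaminarBarlowWindows`, which
quantifies over all `R`, does) or the energy; potential-free and scale-local arguments aim at a false
statement. [new] -/
theorem not_sameScaleBarlowToHcp : ¬ SameScaleBarlowToHcp := by
  intro H
  refine not_tendsto_dimerConfig (H (6 / 5) (1 / 100) (by norm_num) (by norm_num) (by norm_num)
    dimerConfig ?_)
  have h0 : (fun N : ℕ =>
      (Nat.card {i : Fin N // ¬ BarlowMatched (6 / 5) (1 / 100) (dimerConfig N) i} : ℝ) / N) =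
      fun _ => (0 : ℝ) := by
    funext N
    have : Nat.card {i : Fin N // ¬ BarlowMatched (6 / 5) (1 / 100) (dimerConfig N) i} = 0 :=
      Nat.card_eq_zero.mpr (Or.inl ⟨fun ⟨i, hi⟩ => hi (dimerConfig_barlowMatched i)⟩)
    rw [this]
    simp
  rw [h0]
  exact tendsto_const_nhds


/-! ## §5. Vacuous regime `R ≤ ε`: there the counted set is empty for EVERY configuration -/

/-- For `R ≤ ε` (automatic in part of the crux's parameter range, since only `0 < R` and
`0 < ε < 1/4` are asked) every particle of every configuration is hcp-matched: with `a = h = 199/100`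
the `R`-window of a site is the site alone (`R ≤ ε < 1/4 < 199/100`) and every particle within `R` of
`X i` is within `ε` of the centre's image.  So the crux has content only for `R > ε`. [folklore] -/
theorem hcpMatched_of_le {N : ℕ} (X : Fin N → E3) (i : Fin N) {R ε : ℝ} (hRε : R ≤ ε)
    (hR : R < 199 / 100) : HcpMatched R ε X i := by
  refine ⟨199 / 100, 199 / 100, by norm_num, by norm_num, by norm_num, by norm_num,
    barlowPos (199 / 100) (199 / 100) alternatingHagg 0 0 0, barlowPos_mem _ _ _,
    LinearIsometry.id, ?_, ?_⟩
  · intro p hp hpd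
    refine ⟨i, ?_⟩
    have : p = barlowPos (199 / 100) (199 / 100) alternatingHagg 0 0 0 := by
      by_contra hne
      have := le_dist_of_mem_barlowStacking (199 / 100) (199 / 100) alternatingHagg (by norm_num)
        (by norm_num) hp (barlowPos_mem 0 0 0) hne
      rw [min_self] at this
      linarith
    rw [this]
    have : (0 : ℝ) ≤ ε := dist_nonneg.trans (hpd.trans hRε)
    simpa using this
  · intro j hj
    exact ⟨_, barlowPos_mem 0 0 0, by simpa using hj.trans hRε⟩

/-- Hence for `R ≤ ε < 1/4` the counted set of the crux is empty, whatever the configuration. [folklore] -/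
theorem card_bad_eq_zero_of_le {N : ℕ} (X : Fin N → E3) {R ε : ℝ} (hRε : R ≤ ε) (hε : ε < 1 / 4) :
    Nat.card {i : Fin N // BarlowMatched R ε X i ∧ ¬ HcpMatched R ε X i} = 0 :=
  Nat.card_eq_zero.mpr (Or.inl ⟨fun ⟨i, hi⟩ => hi.2 (hcpMatched_of_le X i hRε (by linarith))⟩)

/-! ## §6. Near-miss (not closed): all-scale Barlow order does not give hcp windows either -/

/-- ALL-SCALE TRANSFER: for every sequence of configurations, "Barlow windows a.e. at EVERY scale
`(R, ε)`" implies "hcp windows a.e. among the Barlow-matched, at every scale" — i.e. the GS-free core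
of the conditional restatement `LaminarBarlowWindows → StackingFaultSparsity` (planner note S1).
[new] -/
def AllScaleBarlowToHcp : Prop :=
  ∀ x : (N : ℕ) → (Fin N → E3),
    (∀ R ε : ℝ, 0 < R → 0 < ε → ε < 1 / 4 →
      Filter.Tendsto (fun N : ℕ => (Nat.card {i : Fin N // ¬ BarlowMatched R ε (x N) i} : ℝ) / N)
        Filter.atTop (nhds 0)) →
    ∀ R ε : ℝ, 0 < R → 0 < ε → ε < 1 / 4 →
      Filter.Tendsto (fun N : ℕ =>
        (Nat.card {i : Fin N // BarlowMatched R ε (x N) i ∧ ¬ HcpMatched R ε (x N) i} : ℝ) / N)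
        Filter.atTop (nhds 0)

/-- **Near-miss (open in Lean, true on paper): the all-scale transfer is false too** — witness the
growing fcc crystals `x N =` (the `N` points of `fccStacking 1 √(2/3)` closest to the origin): every
particle at distance `≥ R + 1` from the surface is exactly Barlow-matched at `(R, ε)` (it IS a window
of `barlowStacking 1 √(2/3) constHagg`), and surface particles are `O(R N^{2/3}) = o(N)`; but NO bulk
particle is hcp-matched once `R ≥ 3/2` and `ε ≤ 1/50`, because the two-shell fcc cluster
(cuboctahedron at distance `1` + octahedron at `√2`, 18 points, CENTROSYMMETRIC) is congruent to no
`3/2`-window of any `hcpStacking a h`, `a, h ∈ (1/2, 2)`: an hcp window is invariant under the basal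
mirror (`hcp_twin`), and if it met an odd layer it would not be centrosymmetric up to `2ε` (the
letters above and below the centre's layer coincide, `B` over `B`, while inversion sends `B` to `C`,
lateral defect `a/√3 > 2ε`); so it lies in the even layers, a hexagonal Bravais lattice
`ℤu + ℤv + ℤ(2h e₃)`, whose distance shells from a site have sizes `6` (at `a`), `2` (at `2h`),
`12` (at `√(a² + 4h²)`), `6` (at `a√3`) … and never produce `12` points at one common distance below
all other points — contradiction with the cuboctahedral first shell.  CONSEQUENCE (when closed): even
the conditional form `LaminarBarlowWindows → StackingFaultSparsity` has no potential-free proof; any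
proof must certify that hcp beats fcc-type stackings energetically (Hägg domination,
`e(hcp) < e(fcc)` by `7.25e-5` per particle — items 3063 / 0737 / 12019).  OBSTRUCTION to closing it
here: (i) the `o(N)` surface count for lattice balls, (ii) the metric classification of 18-point
relaxed-hcp windows over the whole box `a, h ∈ (1/2, 2)` — both routine on paper, long in Lean; not
attempted this cycle. [new] -/
theorem not_allScaleBarlowToHcp : ¬ AllScaleBarlowToHcp := by
  sorry


/-! ## §7. The cuboctahedral (fcc) first shell is counted: symmetric twelve-shells are never hcp windows -/

/-- Two-point squared distance in integer coordinates `X = 2Δi + Δj + ΔL`, `Y = 3Δj + ΔL`. -/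
theorem dist_barlowPos_pair_sq (a h : ℝ) (s : ℤ → ℤ) (k i j k' i' j' : ℤ) :
    dist (barlowPos a h s k i j) (barlowPos a h s k' i' j') ^ 2 =
      a ^ 2 * (3 * (2 * (i - i') + (j - j') + (haggLabel s k - haggLabel s k')) ^ 2 +
        (3 * (j - j') + (haggLabel s k - haggLabel s k')) ^ 2 : ℤ) / 12 + ((k - k') * h) ^ 2 := by
  rw [dist_barlowPos_sq]
  have h3 : (√3 : ℝ) ^ 2 = 3 := Real.sq_sqrt (by norm_num)
  push_cast
  linear_combination (a ^ 2 * (3 * (j - j') + (haggLabel s k - haggLabel s k')) ^ 2 / 36) * h3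

/-- Squared norm of `p + p' - 2 z` for three stacking points, in integer coordinates
`X = 2(i + i' - 2i₀) + (j + j' - 2j₀) + Λ`, `Y = 3(j + j' - 2j₀) + Λ`, `Λ = L k + L k' - 2 L k₀`. -/
theorem norm_add_sub_two_sq (a h : ℝ) (s : ℤ → ℤ) (k i j k' i' j' k₀ i₀ j₀ : ℤ) :
    ‖barlowPos a h s k i j + barlowPos a h s k' i' j' - (2 : ℝ) • barlowPos a h s k₀ i₀ j₀‖ ^ 2 =
      a ^ 2 * (3 * (2 * (i + i' - 2 * i₀) + (j + j' - 2 * j₀) +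
          (haggLabel s k + haggLabel s k' - 2 * haggLabel s k₀)) ^ 2 +
        (3 * (j + j' - 2 * j₀) + (haggLabel s k + haggLabel s k' - 2 * haggLabel s k₀)) ^ 2 : ℤ) / 12 +
      ((k + k' - 2 * k₀) * h) ^ 2 := by
  rw [EuclideanSpace.norm_eq, Real.sq_sqrt (Finset.sum_nonneg fun _ _ => sq_nonneg _),
    Fin.sum_univ_three]
  have h3 : (√3 : ℝ) ^ 2 = 3 := Real.sq_sqrt (by norm_num)
  simp only [PiLp.sub_apply, PiLp.add_apply, PiLp.smul_apply, smul_eq_mul, barlowPos_apply_zero,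
    barlowPos_apply_one, barlowPos_apply_two, Real.norm_eq_abs, sq_abs]
  push_cast
  linear_combination (a ^ 2 * (3 * (j + j' - 2 * j₀) +
    (haggLabel s k + haggLabel s k' - 2 * haggLabel s k₀)) ^ 2 / 36) * h3

/-- **Odd layers are excluded by centrosymmetry.** In `hcpStacking a h` (`a, h > 1/2`), if `p` lies an
odd number of layers away from `z`, then `p + p' - 2z` has norm `> 1/50` for every stacking point `p'`:
the inverted point `2z - p` is far from the stacking (its layer carries the letter `C` where the
stacking has `B`). -/
theorem hcp_odd_layer_far {a h : ℝ} (ha : 1 / 2 < a) (hh : 1 / 2 < h) {k i j k' i' j' k₀ i₀ j₀ : ℤ}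
    (hodd : Odd (k - k₀))
    (hsmall : ‖barlowPos a h alternatingHagg k i j + barlowPos a h alternatingHagg k' i' j' -
      (2 : ℝ) • barlowPos a h alternatingHagg k₀ i₀ j₀‖ ≤ 1 / 50) : False := by
  set v := barlowPos a h alternatingHagg k i j + barlowPos a h alternatingHagg k' i' j' -
      (2 : ℝ) • barlowPos a h alternatingHagg k₀ i₀ j₀ with hv
  -- vertical component: k + k' = 2 k₀
  have hvert : k + k' - 2 * k₀ = 0 := by
    by_contra hne
    have h2 : |v 2| ≤ ‖v‖ := by
      have := PiLp.norm_apply_le v 2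
      rwa [Real.norm_eq_abs] at this
    have hv2 : v 2 = ((k : ℝ) + k' - 2 * k₀) * h := by
      simp only [hv, PiLp.sub_apply, PiLp.add_apply, PiLp.smul_apply, smul_eq_mul,
        barlowPos_apply_two]
      ring
    rw [hv2, abs_mul, abs_of_pos (by linarith : (0 : ℝ) < h)] at h2
    have h1 : (1 : ℝ) ≤ |((k : ℝ) + k' - 2 * k₀)| := by
      rw [show ((k : ℝ) + k' - 2 * k₀) = ((k + k' - 2 * k₀ : ℤ) : ℝ) by push_cast; ring,
        ← Int.cast_abs]
      exact_mod_cast Int.one_le_abs hne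
    nlinarith
  -- labels: L k = L k' ≠ L k₀, so Λ = ±2
  have hk' : k' = 2 * k₀ - k := by omega
  have hko : ¬ (Even k ↔ Even k₀) := fun h0 =>
    (Int.not_even_iff_odd.mpr hodd) (Int.even_sub.mpr h0)
  have hkk : (Even k' ↔ Even k) := by rw [hk', Int.even_sub]; simp
  set Λ := haggLabel alternatingHagg k + haggLabel alternatingHagg k' -
      2 * haggLabel alternatingHagg k₀ with hΛdef
  have hΛ : Λ = 2 ∨ Λ = -2 := by
    rw [hΛdef, haggLabel_alternating, haggLabel_alternating, haggLabel_alternating]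
    by_cases hk : Even k
    · have h0 : ¬ Even k₀ := fun h0 => hko (iff_of_true hk h0)
      have hk'' : Even k' := hkk.mpr hk
      simp [hk, h0, hk'']
    · have h0 : Even k₀ := by
        by_contra h0; exact hko (iff_of_false hk h0)
      have hk'' : ¬ Even k' := fun h' => hk (hkk.mp h')
      simp [hk, h0, hk'']
  -- the integer form
  have hsq := norm_add_sub_two_sq a h alternatingHagg k i j k' i' j' k₀ i₀ j₀
  rw [← hΛdef] at hsq
  set X : ℤ := 2 * (i + i' - 2 * i₀) + (j + j' - 2 * j₀) + Λ with hX
  set Y : ℤ := 3 * (j + j' - 2 * j₀) + Λ with hY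
  have hY0 : Y ≠ 0 := by rcases hΛ with h0 | h0 <;> omega
  have hXY : ((X, Y) : ℤ × ℤ) ≠ 0 := by
    intro h0; rw [Prod.mk_eq_zero] at h0; exact hY0 h0.2
  have h4 : 4 ≤ 3 * X ^ 2 + Y ^ 2 := four_le_of_parity ⟨(i + i' - 2 * i₀) - (j + j' - 2 * j₀), by
    rw [hX, hY]; ring⟩ hXY
  have h4' : (4 : ℝ) ≤ ((3 * X ^ 2 + Y ^ 2 : ℤ) : ℝ) := by exact_mod_cast h4
  have hvert' : ((k : ℝ) + k' - 2 * k₀) = 0 := by exact_mod_cast hvert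
  rw [hvert', zero_mul, zero_pow two_ne_zero, add_zero] at hsq
  -- ‖v‖² ≥ a²/3 > 1/12, but ‖v‖ ≤ 1/50
  have hv2 : ‖v‖ ^ 2 ≤ (1 / 50) ^ 2 := by gcongr
  rw [hsq] at hv2
  nlinarith

/-- The integer solutions of `m² + mn + n² = 1` (the six unit vectors of the triangular lattice). -/
theorem loeschian_eq_one {m n : ℤ} (h : m ^ 2 + m * n + n ^ 2 = 1) :
    (m = 1 ∧ n = 0) ∨ (m = 0 ∧ n = 1) ∨ (m = -1 ∧ n = 0) ∨ (m = 0 ∧ n = -1) ∨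
      (m = 1 ∧ n = -1) ∨ (m = -1 ∧ n = 1) := by
  have h3n : 3 * n ^ 2 ≤ 4 := by nlinarith [sq_nonneg (2 * m + n)]
  have h3m : 3 * m ^ 2 ≤ 4 := by nlinarith [sq_nonneg (2 * n + m)]
  have hn : n ^ 2 ≤ 1 := by
    have : n ^ 2 < 2 := by linarith
    have := Int.lt_iff_add_one_le.mp this; linarith
  have hm : m ^ 2 ≤ 1 := by
    have : m ^ 2 < 2 := by linarith
    have := Int.lt_iff_add_one_le.mp this; linarith
  have hn' := abs_le.mp ((sq_le_one_iff_abs_le_one n).mp hn)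
  have hm' := abs_le.mp ((sq_le_one_iff_abs_le_one m).mp hm)
  obtain ⟨hm1, hm2⟩ := hm'
  obtain ⟨hn1, hn2⟩ := hn'
  have h' : m * m + m * n + n * n = 1 := by linear_combination h
  clear h h3n h3m hn hm
  interval_cases m <;> interval_cases n <;> omega

/-- The eight even-layer candidates for hcp points at distance `≈ 1` from a site: the six in-layer
neighbours and the two sites straight above/below two layers away. -/
def D8 : Finset (ℤ × ℤ × ℤ) :=
  {(0, 1, 0), (0, 0, 1), (0, -1, 0), (0, 0, -1), (0, 1, -1), (0, -1, 1), (2, 0, 0), (-2, 0, 0)}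

theorem card_D8 : D8.card = 8 := by decide

/-- **Even-layer census.** In `hcpStacking a h` with `a ≥ 99/100`, `h > 1/2`, a point an even number
of layers away from `z` at distance in `[99/100, 101/100]` is one of the eight candidates `D8`. -/
theorem hcp_even_census {a h : ℝ} (ha : 99 / 100 ≤ a) (hh : 1 / 2 < h) {k i j k₀ i₀ j₀ : ℤ}
    (heven : Even (k - k₀))
    (hlo : 99 / 100 ≤ dist (barlowPos a h alternatingHagg k i j) (barlowPos a h alternatingHagg k₀ i₀ j₀))
    (hhi : dist (barlowPos a h alternatingHagg k i j) (barlowPos a h alternatingHagg k₀ i₀ j₀) ≤ 101 / 100) :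
    (k - k₀, i - i₀, j - j₀) ∈ D8 := by
  have hL : haggLabel alternatingHagg k = haggLabel alternatingHagg k₀ := by
    rw [haggLabel_alternating, haggLabel_alternating]
    have : Even k ↔ Even k₀ := Int.even_sub.mp heven
    simp only [this]
  have hsq := dist_barlowPos_pair_sq a h alternatingHagg k i j k₀ i₀ j₀
  rw [hL, sub_self] at hsq
  set q : ℤ := (i - i₀) ^ 2 + (i - i₀) * (j - j₀) + (j - j₀) ^ 2 with hq
  have hform : (3 * (2 * (i - i₀) + (j - j₀) + 0) ^ 2 + (3 * (j - j₀) + 0) ^ 2 : ℤ) = 12 * q := by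
    rw [hq]; ring
  rw [hform] at hsq
  push_cast at hsq
  set d := dist (barlowPos a h alternatingHagg k i j) (barlowPos a h alternatingHagg k₀ i₀ j₀) with hd
  have hd2lo : (99 / 100) ^ 2 ≤ d ^ 2 := by gcongr
  have hd2hi : d ^ 2 ≤ (101 / 100) ^ 2 := by gcongr
  have hqnn : (0 : ℤ) ≤ q := by
    have := one_le_sq_add_mul_add_sq (p := i - i₀) (q := j - j₀)
    by_cases h0 : ((i - i₀, j - j₀) : ℤ × ℤ) = 0
    · rw [Prod.mk_eq_zero] at h0; rw [hq, h0.1, h0.2]; norm_num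
    · linarith [this h0]
  have hqnn' : (0 : ℝ) ≤ (q : ℝ) := by exact_mod_cast hqnn
  have ha2 : (9801 / 10000 : ℝ) ≤ a ^ 2 := by nlinarith
  have hh2 : (1 / 4 : ℝ) < h ^ 2 := by nlinarith
  -- |k - k₀| ≤ 2
  have hk : (k - k₀) ^ 2 ≤ 4 := by
    by_contra hk
    have hk5 : (5 : ℤ) ≤ (k - k₀) ^ 2 := by
      push Not at hk; have : 4 < (k - k₀) ^ 2 := hk; omega
    have : (5 : ℝ) ≤ ((k : ℝ) - k₀) ^ 2 := by exact_mod_cast hk5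
    nlinarith
  have hk' : -2 ≤ k - k₀ ∧ k - k₀ ≤ 2 := by constructor <;> nlinarith
  have hcases : k - k₀ = 0 ∨ k - k₀ = 2 ∨ k - k₀ = -2 := by
    rcases heven with ⟨m, hm⟩
    omega
  rcases hcases with h0 | h0 | h0
  · -- same layer: a² q ∈ [0.98, 1.02] ⇒ q = 1
    have h0' : (k : ℝ) - k₀ = 0 := by exact_mod_cast h0
    rw [h0', zero_mul, zero_pow two_ne_zero, add_zero] at hsq
    have hq1 : q ≤ 1 := by
      by_contra hq2
      have : (2 : ℤ) ≤ q := by omega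
      have : (2 : ℝ) ≤ (q : ℝ) := by exact_mod_cast this
      nlinarith
    have hq1' : 1 ≤ q := by
      by_contra hq0
      have : q ≤ 0 := by omega
      have : (q : ℝ) ≤ 0 := by exact_mod_cast this
      nlinarith
    have hq_eq : (i - i₀) ^ 2 + (i - i₀) * (j - j₀) + (j - j₀) ^ 2 = 1 := by rw [← hq]; omega
    rw [h0]
    rcases loeschian_eq_one hq_eq with ⟨h1, h2⟩ | ⟨h1, h2⟩ | ⟨h1, h2⟩ | ⟨h1, h2⟩ | ⟨h1, h2⟩ | ⟨h1, h2⟩ <;>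
      rw [h1, h2] <;> decide
  · -- two layers up: q = 0
    have h0' : (k : ℝ) - k₀ = 2 := by exact_mod_cast h0
    rw [h0'] at hsq
    have hq0 : q ≤ 0 := by
      by_contra hq1
      have : (1 : ℤ) ≤ q := by omega
      have : (1 : ℝ) ≤ (q : ℝ) := by exact_mod_cast this
      nlinarith
    have hij : ((i - i₀, j - j₀) : ℤ × ℤ) = 0 := by
      by_contra hne
      have := one_le_sq_add_mul_add_sq hne
      omega
    rw [Prod.mk_eq_zero] at hij
    rw [h0, hij.1, hij.2]; decide
  · have h0' : (k : ℝ) - k₀ = -2 := by exact_mod_cast h0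
    rw [h0'] at hsq
    have hq0 : q ≤ 0 := by
      by_contra hq1
      have : (1 : ℤ) ≤ q := by omega
      have : (1 : ℝ) ≤ (q : ℝ) := by exact_mod_cast this
      nlinarith
    have hij : ((i - i₀, j - j₀) : ℤ × ℤ) = 0 := by
      by_contra hne
      have := one_le_sq_add_mul_add_sq hne
      omega
    rw [Prod.mk_eq_zero] at hij
    rw [h0, hij.1, hij.2]; decide

/-- **A centrosymmetric twelve-shell at distance `1` is never an hcp window** (`R = 1`, `ε = 1/100`):
if twelve pairwise `≥ 1`-separated particles sit at distance exactly `1` from `X i`, closed under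
`v ↦ -v`, and no other particle is strictly within distance `1`, then `i` is matched to no relaxed
hcp.  Centrosymmetry excludes model points in odd layers (`hcp_odd_layer_far`), and the even layers
offer only eight candidates (`hcp_even_census`) for twelve distinct model points. -/
theorem not_hcpMatched_of_symmetric_shell {N : ℕ} (X : Fin N → E3) (i : Fin N) (S : Finset (Fin N))
    (hS : S.card = 12) (hS1 : ∀ j ∈ S, dist (X j) (X i) = 1)
    (hSsep : ∀ j ∈ S, ∀ j' ∈ S, j ≠ j' → 1 ≤ dist (X j) (X j'))
    (hSsymm : ∀ j ∈ S, ∃ j' ∈ S, X j' - X i = -(X j - X i))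
    (hgap : ∀ j : Fin N, dist (X j) (X i) < 1 → X j = X i) :
    ¬ HcpMatched 1 (1 / 100) X i := by
  rintro ⟨a, h, ha1, -, hh1, -, z, ⟨k₀, i₀, j₀, rfl⟩, A, h1, h2⟩
  -- Step A: a ≥ 99/100 (the in-layer neighbour of the centre must carry a particle or be far)
  have ha99 : 99 / 100 ≤ a := by
    by_contra hlt
    push Not at hlt
    have hd : dist (barlowPos a h alternatingHagg k₀ (i₀ + 1) j₀)
        (barlowPos a h alternatingHagg k₀ i₀ j₀) = a := by
      have h2' : dist (barlowPos a h alternatingHagg k₀ (i₀ + 1) j₀)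
          (barlowPos a h alternatingHagg k₀ i₀ j₀) ^ 2 = a ^ 2 := by
        rw [dist_barlowPos_pair_sq]; push_cast; ring
      rw [← Real.sqrt_sq dist_nonneg, h2', Real.sqrt_sq (by linarith)]
    obtain ⟨j, hj⟩ := h1 _ (barlowPos_mem _ _ _) (by rw [hd]; linarith)
    have hn : ‖A (barlowPos a h alternatingHagg k₀ (i₀ + 1) j₀ - barlowPos a h alternatingHagg k₀ i₀ j₀)‖
        = a := by rw [LinearIsometry.norm_map, ← dist_eq_norm, hd]
    have hji : dist (X j) (X i) < 1 := by
      have := dist_triangle (X j) (X i + A (barlowPos a h alternatingHagg k₀ (i₀ + 1) j₀ -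
        barlowPos a h alternatingHagg k₀ i₀ j₀)) (X i)
      rw [dist_eq_norm (X i + _) (X i), add_sub_cancel_left, hn] at this
      linarith
    have hjj := hgap j hji
    rw [hjj, dist_eq_norm, sub_add_cancel_left, norm_neg, hn] at hj
    linarith
  -- Step B: model points of the twelve shell particles
  have hP : ∀ j ∈ S, ∃ p ∈ hcpStacking a h,
      dist (X j) (X i + A (p - barlowPos a h alternatingHagg k₀ i₀ j₀)) ≤ 1 / 100 :=
    fun j hj => h2 j (by rw [hS1 j hj])
  choose! P hPmem hPd using hP
  have hPrep : ∀ j ∈ S, ∃ t : ℤ × ℤ × ℤ, P j = barlowPos a h alternatingHagg t.1 t.2.1 t.2.2 :=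
    fun j hj => by obtain ⟨k, i', j', h0⟩ := hPmem j hj; exact ⟨(k, i', j'), h0⟩
  choose! T hT using hPrep
  set z := barlowPos a h alternatingHagg k₀ i₀ j₀ with hz
  have hnormP : ∀ j ∈ S, ‖A (P j - z)‖ = dist (P j) z := fun j _ => by
    rw [LinearIsometry.norm_map, dist_eq_norm]
  have hPz : ∀ j ∈ S, 99 / 100 ≤ dist (P j) z ∧ dist (P j) z ≤ 101 / 100 := by
    intro j hj
    have e1 := hPd j hj
    have e2 := hS1 j hj
    have t1 := dist_triangle (X j) (X i + A (P j - z)) (X i)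
    have t2 := dist_triangle (X i + A (P j - z)) (X j) (X i)
    rw [dist_eq_norm (X i + _) (X i), add_sub_cancel_left, hnormP j hj] at t1 t2
    rw [dist_comm (X i + A (P j - z)) (X j)] at t2
    constructor <;> linarith
  -- parity: odd layers are excluded by the centrosymmetry of the shell
  have hEven : ∀ j ∈ S, Even ((T j).1 - k₀) := by
    intro j hj
    by_contra hodd
    rw [Int.not_even_iff_odd] at hodd
    obtain ⟨j', hj', hsymm⟩ := hSsymm j hj
    refine hcp_odd_layer_far ha1 hh1 hodd (i := (T j).2.1) (j := (T j).2.2) (k' := (T j').1)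
      (i' := (T j').2.1) (j' := (T j').2.2) (i₀ := i₀) (j₀ := j₀) ?_
    rw [← hT j hj, ← hT j' hj', ← hz]
    have hsum : P j + P j' - (2 : ℝ) • z = (P j - z) + (P j' - z) := by rw [two_smul]; abel
    have h0 : (X i - X j) + (X i - X j') = 0 := by
      have : X i - X j' = -(X j' - X i) := by abel
      rw [this, hsymm]; abel
    have key : A (P j - z) + A (P j' - z) =
        (X i + A (P j - z) - X j) + (X i + A (P j' - z) - X j') := by
      have : (X i + A (P j - z) - X j) + (X i + A (P j' - z) - X j') =
          (A (P j - z) + A (P j' - z)) + ((X i - X j) + (X i - X j')) := by abel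
      rw [this, h0, add_zero]
    rw [← A.norm_map, hsum, map_add, key]
    refine (norm_add_le _ _).trans ?_
    rw [← dist_eq_norm, ← dist_eq_norm, dist_comm]
    have e1 := hPd j hj
    have e2 := hPd j' hj'
    rw [dist_comm] at e2
    linarith
  -- census: every model point is one of eight candidates
  have hΦ : ∀ j ∈ S, ((T j).1 - k₀, (T j).2.1 - i₀, (T j).2.2 - j₀) ∈ D8 := by
    intro j hj
    have hlo := (hPz j hj).1
    have hhi := (hPz j hj).2
    rw [hT j hj] at hlo hhi
    exact hcp_even_census ha99 hh1 (hEven j hj) hlo hhi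
  -- injectivity: distinct shell particles have distinct model points
  have hinj : Set.InjOn (fun j => ((T j).1 - k₀, (T j).2.1 - i₀, (T j).2.2 - j₀)) S := by
    intro j hj j' hj' heq
    simp only [Prod.mk.injEq] at heq
    have hTT : T j = T j' := Prod.ext (by omega) (Prod.ext (by omega) (by omega))
    have hPP : P j = P j' := by rw [hT j hj, hT j' hj', hTT]
    by_contra hne
    have h1le := hSsep j hj j' hj' hne
    have t := dist_triangle (X j) (X i + A (P j - z)) (X j')
    have e1 := hPd j hj
    have e2 := hPd j' hj'
    rw [← hPP, dist_comm] at e2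
    linarith
  have hcard := Finset.card_le_card_of_injOn _ hΦ hinj
  rw [hS, card_D8] at hcard
  omega

/-! ### The fcc side: the ideal cuboctahedral cluster -/

/-- Ideal layer spacing `h₀ = √(2/3)` for in-layer spacing `1`. -/
def h₀ : ℝ := √(2 / 3)

theorem h₀_sq : h₀ ^ 2 = 2 / 3 := Real.sq_sqrt (by norm_num)

theorem half_lt_h₀ : 1 / 2 < h₀ := by
  rw [h₀, show (1 / 2 : ℝ) = √(1 / 4) by
    rw [show (1 / 4 : ℝ) = (1 / 2) ^ 2 by norm_num, Real.sqrt_sq (by norm_num)]]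
  exact Real.sqrt_lt_sqrt (by norm_num) (by norm_num)

theorem h₀_lt_two : h₀ < 2 := by
  rw [h₀, show (2 : ℝ) = √4 by
    rw [show (4 : ℝ) = 2 ^ 2 by norm_num, Real.sqrt_sq (by norm_num)]]
  exact Real.sqrt_lt_sqrt (by norm_num) (by norm_num)

/-- Points of the ideal fcc lattice `fccStacking 1 h₀` (nearest-neighbour distance `1`). -/
def fccPos (k i j : ℤ) : E3 := barlowPos 1 h₀ constHagg k i j

/-- The fcc quadratic form (the `A₃` root form in stacking coordinates). -/
def fccQ (x y z : ℤ) : ℤ := x ^ 2 + y ^ 2 + z ^ 2 + x * y + x * z + y * z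

/-- **Squared fcc distances are values of the integral form `fccQ`.** -/
theorem dist_fccPos_sq (k i j k' i' j' : ℤ) :
    dist (fccPos k i j) (fccPos k' i' j') ^ 2 = (fccQ (k - k') (i - i') (j - j') : ℤ) := by
  rw [fccPos, fccPos, dist_barlowPos_pair_sq, haggLabel_const, haggLabel_const, mul_pow, h₀_sq, fccQ]
  push_cast
  ring

/-- Distinct fcc points are at distance `≥ 1`. -/
theorem one_le_dist_fccPos {k i j k' i' j' : ℤ} (hne : fccPos k i j ≠ fccPos k' i' j') :
    1 ≤ dist (fccPos k i j) (fccPos k' i' j') := by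
  have hsq := dist_fccPos_sq k i j k' i' j'
  have hpos : 0 < dist (fccPos k i j) (fccPos k' i' j') := dist_pos.mpr hne
  have hQpos : (0 : ℝ) < (fccQ (k - k') (i - i') (j - j') : ℤ) := by rw [← hsq]; positivity
  have hQ1 : (1 : ℤ) ≤ fccQ (k - k') (i - i') (j - j') := by
    have : (0 : ℤ) < fccQ (k - k') (i - i') (j - j') := by exact_mod_cast hQpos
    omega
  have hQ1' : (1 : ℝ) ≤ (fccQ (k - k') (i - i') (j - j') : ℤ) := by exact_mod_cast hQ1
  nlinarith

/-- fcc is centrosymmetric about each site: `fccPos (-k) (-i) (-j) = - fccPos k i j`. -/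
theorem fccPos_neg (k i j : ℤ) : fccPos (-k) (-i) (-j) = -fccPos k i j := by
  ext l
  fin_cases l <;> simp [fccPos] <;> ring

theorem fccPos_zero : fccPos 0 0 0 = 0 := by
  ext l
  fin_cases l <;> simp [fccPos]

/-- The origin and the twelve roots: stacking coordinates `(k, i, j)` of the cuboctahedral cluster. -/
def D13 : Finset (ℤ × ℤ × ℤ) :=
  {(0, 0, 0), (0, 1, 0), (0, 0, 1), (0, -1, 0), (0, 0, -1), (0, 1, -1), (0, -1, 1),
    (1, 0, 0), (1, -1, 0), (1, 0, -1), (-1, 0, 0), (-1, 1, 0), (-1, 0, 1)}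

/-- **fcc census at radius `1`:** `fccQ ≤ 1` only at the origin and the twelve roots. -/
theorem mem_D13_of_fccQ_le_one {x y z : ℤ} (hQ : fccQ x y z ≤ 1) : (x, y, z) ∈ D13 := by
  have h2 : 2 * fccQ x y z = x ^ 2 + y ^ 2 + z ^ 2 + (x + y + z) ^ 2 := by rw [fccQ]; ring
  have hx : x ^ 2 ≤ 2 := by nlinarith [sq_nonneg y, sq_nonneg z, sq_nonneg (x + y + z)]
  have hy : y ^ 2 ≤ 2 := by nlinarith [sq_nonneg x, sq_nonneg z, sq_nonneg (x + y + z)]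
  have hz : z ^ 2 ≤ 2 := by nlinarith [sq_nonneg y, sq_nonneg x, sq_nonneg (x + y + z)]
  have hx1 : x ^ 2 < 2 ^ 2 := by linarith
  have hy1 : y ^ 2 < 2 ^ 2 := by linarith
  have hz1 : z ^ 2 < 2 ^ 2 := by linarith
  obtain ⟨hxa, hxb⟩ := abs_lt_of_sq_lt_sq' hx1 (by norm_num)
  obtain ⟨hya, hyb⟩ := abs_lt_of_sq_lt_sq' hy1 (by norm_num)
  obtain ⟨hza, hzb⟩ := abs_lt_of_sq_lt_sq' hz1 (by norm_num)
  have hQ' : x * x + y * y + z * z + x * y + x * z + y * z ≤ 1 := by rw [fccQ] at hQ; linarith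
  clear hQ h2 hx hy hz hx1 hy1 hz1
  interval_cases x <;> interval_cases y <;> interval_cases z <;> first | omega | decide

/-- The cluster coordinates as a table. -/
def cuboIdx : Fin 13 → ℤ × ℤ × ℤ :=
  ![(0, 0, 0), (0, 1, 0), (0, 0, 1), (0, -1, 0), (0, 0, -1), (0, 1, -1), (0, -1, 1),
    (1, 0, 0), (1, -1, 0), (1, 0, -1), (-1, 0, 0), (-1, 1, 0), (-1, 0, 1)]

theorem exists_cuboIdx_eq : ∀ t ∈ D13, ∃ n : Fin 13, cuboIdx n = t := by decide

theorem fccQ_cuboIdx : ∀ n : Fin 13, n ≠ 0 →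
    fccQ (cuboIdx n).1 (cuboIdx n).2.1 (cuboIdx n).2.2 = 1 := by decide

theorem fccQ_cuboIdx_sub : ∀ n n' : Fin 13, n ≠ n' →
    1 ≤ fccQ ((cuboIdx n).1 - (cuboIdx n').1) ((cuboIdx n).2.1 - (cuboIdx n').2.1)
      ((cuboIdx n).2.2 - (cuboIdx n').2.2) := by decide

theorem cuboIdx_symm : ∀ n : Fin 13, n ≠ 0 → ∃ n' : Fin 13, n' ≠ 0 ∧
    cuboIdx n' = (-(cuboIdx n).1, -(cuboIdx n).2.1, -(cuboIdx n).2.2) := by decide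

theorem cuboIdx_zero : cuboIdx 0 = (0, 0, 0) := rfl

/-- **The ideal cuboctahedral cluster**: a centre and its twelve fcc nearest neighbours at distance
`1` (the first coordination shell of the face-centred cubic packing). -/
def cuboConfig : Fin 13 → E3 := fun n => fccPos (cuboIdx n).1 (cuboIdx n).2.1 (cuboIdx n).2.2

theorem cuboConfig_zero : cuboConfig 0 = 0 := by
  simp only [cuboConfig, cuboIdx_zero]; exact fccPos_zero

theorem dist_cuboConfig_zero {n : Fin 13} (hn : n ≠ 0) : dist (cuboConfig n) (cuboConfig 0) = 1 := by
  have hsq : dist (cuboConfig n) (cuboConfig 0) ^ 2 = 1 := by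
    simp only [cuboConfig, cuboIdx_zero]
    rw [dist_fccPos_sq]
    simp only [sub_zero]
    exact_mod_cast fccQ_cuboIdx n hn
  nlinarith [dist_nonneg (x := cuboConfig n) (y := cuboConfig 0)]

/-- **The centre of the cuboctahedral cluster is Barlow-matched** at `(R, ε) = (1, 1/100)` (indeed
exactly, to `fccStacking 1 h₀`). -/
theorem barlowMatched_cuboConfig : BarlowMatched 1 (1 / 100) cuboConfig 0 := by
  refine ⟨1, h₀, by norm_num, by norm_num, half_lt_h₀, h₀_lt_two, constHagg, isHaggSeq_const,
    fccPos 0 0 0, barlowPos_mem _ _ _, LinearIsometry.id, ?_, ?_⟩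
  · rintro p ⟨k, i, j, rfl⟩ hpd
    have hpd' : dist (fccPos k i j) (fccPos 0 0 0) ≤ 1 := hpd
    have hQ : fccQ k i j ≤ 1 := by
      have hsq := dist_fccPos_sq k i j 0 0 0
      simp only [sub_zero] at hsq
      have h2 : dist (fccPos k i j) (fccPos 0 0 0) ^ 2 ≤ 1 := by
        have h0 : (0 : ℝ) ≤ dist (fccPos k i j) (fccPos 0 0 0) := dist_nonneg
        nlinarith
      have : ((fccQ k i j : ℤ) : ℝ) ≤ 1 := by rw [← hsq]; exact h2
      exact_mod_cast this
    obtain ⟨n, hn⟩ := exists_cuboIdx_eq _ (mem_D13_of_fccQ_le_one hQ)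
    refine ⟨n, ?_⟩
    have : cuboConfig n = fccPos k i j := by
      simp only [cuboConfig, hn]
    rw [this, cuboConfig_zero, fccPos_zero]
    simp [fccPos]
  · intro n _
    refine ⟨cuboConfig n, barlowPos_mem _ _ _, ?_⟩
    rw [cuboConfig_zero, fccPos_zero]
    simp

/-- **… and it is not hcp-matched** there: the cuboctahedron (fcc first shell) is congruent to no
`1`-window of any relaxed hcp `hcpStacking a h`, `a, h ∈ (1/2, 2)`, at tolerance `1/100`. -/
theorem not_hcpMatched_cuboConfig : ¬ HcpMatched 1 (1 / 100) cuboConfig 0 := by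
  refine not_hcpMatched_of_symmetric_shell cuboConfig 0 (Finset.univ.filter (· ≠ 0)) (by decide)
    (fun n hn => dist_cuboConfig_zero (Finset.mem_filter.mp hn).2) ?_ ?_ ?_
  · intro n hn n' hn' hne
    simp only [cuboConfig]
    have hsq := dist_fccPos_sq (cuboIdx n).1 (cuboIdx n).2.1 (cuboIdx n).2.2
      (cuboIdx n').1 (cuboIdx n').2.1 (cuboIdx n').2.2
    have h1 : (1 : ℝ) ≤ (fccQ ((cuboIdx n).1 - (cuboIdx n').1) ((cuboIdx n).2.1 - (cuboIdx n').2.1)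
      ((cuboIdx n).2.2 - (cuboIdx n').2.2) : ℤ) := by exact_mod_cast fccQ_cuboIdx_sub n n' hne
    rw [← hsq] at h1
    nlinarith [dist_nonneg (x := fccPos (cuboIdx n).1 (cuboIdx n).2.1 (cuboIdx n).2.2)
      (y := fccPos (cuboIdx n').1 (cuboIdx n').2.1 (cuboIdx n').2.2)]
  · intro n hn
    obtain ⟨n', hn'0, hn'⟩ := cuboIdx_symm n (Finset.mem_filter.mp hn).2
    refine ⟨n', Finset.mem_filter.mpr ⟨Finset.mem_univ _, hn'0⟩, ?_⟩
    rw [cuboConfig_zero, sub_zero, sub_zero]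
    simp only [cuboConfig, hn']
    exact fccPos_neg _ _ _
  · intro n hn
    by_contra hne
    have h0 : n ≠ 0 := fun h0 => hne (by rw [h0])
    rw [dist_cuboConfig_zero h0] at hn
    exact lt_irrefl _ hn

/-- **The cuboctahedral (fcc) coordination is counted by the crux.** At `(R, ε) = (1, 1/100)` the
centre of the ideal 13-particle cuboctahedral cluster is Barlow-matched and not hcp-matched.  Read
contrapositively for ground states: `StackingFaultSparsity` at `(1, 1/100)` asserts in particular that
(exactly scaled) fcc-coordinated sites have density `→ 0` in Lennard-Jones ground states — the
stacking-selection content that only the energetics can supply. -/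
theorem cuboConfig_centre_counted :
    BarlowMatched 1 (1 / 100) cuboConfig 0 ∧ ¬ HcpMatched 1 (1 / 100) cuboConfig 0 :=
  ⟨barlowMatched_cuboConfig, not_hcpMatched_cuboConfig⟩

end Summit.AtomisticToContinuum.Crystallization.Cruxes.StackingFaultSparsity.Disproof

end
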